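import Mathlib.NumberTheory.Cyclotomic.Basic
import Literature.NumberTheory.EllipticCurves.Kobayashi2003.SignedKatoDivisibility
import Literature.NumberTheory.EllipticCurves.PAdicLFunctionMinus
import Literature.NumberTheory.EllipticCurves.ImaginaryPeriod
import HarnessLib

/-!
# Kobayashi 2003, Thm. 4.1 (PLUS sign, both tame characters) at `p = 3`, read over `K = ℚ(ζ₃)`:
# `Char_Λ X⁺(E/ℚ(ζ_{3^∞})) ∋ u · L₃⁺(E, X) · L₃⁺(E, ω, X)` for `ρ_{E,3^∞}` onto

Topic `Literature/NumberTheory/EllipticCurves`, cluster `Kobayashi2003` (namespace = path); the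
supersingular SIBLING of `Kato2004.charIdeal_dvd_padicLFunction_cyclotomicThree_of_surjective`
(Kato Thm. 17.4 (3) at `p = 3` over `ℚ(ζ₃)`, good ORDINARY) and of
`Kobayashi2003.thm41_signedCharIdeal_divisibility` (Thm. 4.1 for the trivial tame character,
`F = ℚ`). ONE NAMED FACT (`def … : Prop`, nothing asserted, D-0014; net debt +1): Kobayashi's
Theorem 4.1 for the sign `+` and BOTH characters `η ∈ {1, ω}` of `Δ = Gal(ℚ(ζ₃)/ℚ)`, together with
his Thm. 2.2 (`X⁺` finitely generated `Λ`-torsion) and Thm. 3.2 / (3.6) (existence of Pollack's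
`L_p⁺(E, ω, X)` and its value at `X = 0`), transcribed WITHOUT any descent to the `ℤ₃`-extension of
`ℚ`: at `p = 3` the tower `K_n = ℚ(ζ_{3^{n+1}})` of the paper IS the cyclotomic `ℤ₃`-extension of
the number field `K_0 = ℚ(ζ₃)`, over which the tree's signed Selmer vocabulary
(`Kobayashi2003/SignedSelmer.lean`, written for any number field `K` and `ℤ_p`-extension `κ`)
applies verbatim.

HONEST FRAMING (BSD rank-`≤ 1` residual cell `b2b-bsdres`, seat additive-p4, gen 8, line V18): the
consumer is the research route on the CONSTRUCTION-SHAPED class X4 at `p = 3` — the additive pairs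
`(W, 3)` whose twist `V = W^{(−3)}` is good SUPERSINGULAR at `3` with `a₃(V) = 0`; no label of the
cell moves; nothing is booked; this is not "finishing BSD".

## Source, read at the page (held copy `paper:doi-10-1007-s00222-002-0265-4`)

S. Kobayashi, *Iwasawa theory for elliptic curves at supersingular primes*, Invent. Math. **152**
(2003) 1–36 [Kobayashi2003]. §2 (p. 4): "Let `p` be an odd prime number. We fix a generator
`(ζ_{p^n})` of `ℤ_p(1)` … We denote `K_n = ℚ(ζ_{p^{n+1}})`, `K_{−1} = ℚ` and `K_∞ = ∪_n K_n`. Let `E`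
be an elliptic curve over `ℚ` with good reduction at `p`. We assume that `a_p = 0`. … We define
subgroups `E^±(K_{n,v})` of `E(K_{n,v})` by
`E⁺(K_{n,v}) = {P ∈ E(K_{n,v}) | Tr_{n/m+1} P ∈ E(K_{m,v}) for even m (0 ≤ m < n)}`,
`E⁻(K_{n,v}) = {P ∈ E(K_{n,v}) | Tr_{n/m+1} P ∈ E(K_{m,v}) for odd m (−1 ≤ m < n)}`";
**Def. 2.1** (p. 5): "`Sel^±(E/K_n) := Ker( Sel(E/K_n) → ∏_v H¹(K_{n,v}, E[p^∞]) / E^±(K_{n,v}) ⊗ ℚ_p/ℤ_p )`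
and `Sel^±(E/K_∞) := lim→_n Sel^±(E/K_n)`. We denote the Pontryagin dual of Selmer groups by “`X`”.
… Let `G_n = Gal(K_n/ℚ)` and `G_∞ = lim← G_n`. Then `Λ_n = ℤ_p[G_n]` acts naturally on `X^±(E/K_n)`
and `Λ = ℤ_p[[G_∞]]` on `X^±(E/K_∞)`. **Theorem 2.2.** The Pontryagin dual of the even (odd) Selmer
group `X^±(E/K_∞)` is a finitely generated torsion `Λ`-module." §3 (p. 5): "`G_∞ = Δ × Γ`, where
`Δ ≅ ℤ/(p−1)ℤ` and `Γ ≅ ℤ_p`. We fix a topological generator `γ ∈ Γ`. Then we identify `ℤ_p[[Γ]]`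
with `ℤ_p[[X]]` and `Λ` with `ℤ_p[Δ][[X]]` by identifying `γ` with `1 + X`." Thm. 3.1 (p. 6): "Let
`η : Δ → ℤ_p^×` be a character with sign `δ = η(−1)`. … Let `Ω_E^±` be the real and imaginary Néron
periods." **Theorem 3.2 (Pollack)** (p. 7): "There exist power series `L_p^±(E, η, X)` in `ℤ_p[[X]]`
satisfying `L_p(E, α, η, X) = L_p⁻(E, η, X) log_p⁺(1+X) + L_p⁺(E, η, X) log_p⁻(1+X) α` …
We call `L_p^±(E, η, X)` Pollack's `p`-adic `L`-function. If `η` is trivial, we simply write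
`L_p^±(E, X)` … We remark that our sign of Pollack's `p`-adic `L`-function is opposite to that in
[18]." (3.6)–(3.7) (p. 7): "`L_p⁺(E, 0) = 2 L(E,1)/Ω_E`, `L_p⁻(E, 0) = (p − 1) L(E,1)/Ω_E`, and for
`η ≠ 1` `L_p⁺(E, η, 0) = −(p/τ(η)) · L(E, η̄, 1)/Ω_E^δ`, `L_p⁻(E, η, 0) = 0`." §4 (p. 8): "Let
`η : Δ → ℤ_p^×` be a character. For a `ℤ_p[Δ]`-module `M`, let `M^η` denote the `η`-component of `M`.
If we denote `ε_η = (1/#Δ) ∑_{τ ∈ Δ} η(τ)⁻¹ τ`, `M^η` is given by `ε_η M`. If `η` is trivial, we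
replace the superscript `η` by `Δ`. … By Theorem 2.2, `X^±(E/K_∞)^η` is a torsion
`ℤ_p[[Γ]]`-module. … **Theorem 4.1.** There exists an integer `n ≥ 0` such that
`Char(X⁺(E/K_∞)^η) ⊇ (pⁿ L_p⁺(E, η, X))`, `Char(X⁻(E/K_∞)^Δ) ⊇ (pⁿ L_p⁻(E, X))`,
`Char(X⁻(E/K_∞)^η) ⊇ (pⁿ X⁻¹ L_p⁻(E, η, X))` for `η ≠ 1`. If the `p`-adic representation
`Gal(ℚ̄/ℚ) → GL_{ℤ_p}(T)` is surjective, then we can take `n = 0`. Here `T = T_p E` is the `p`-adic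
Tate module of `E`. *Proof.* This theorem is proved in Sect. 7."

## The reading (`p = 3`, sign `+`; flags for the referee `Ko03-Thm41-p3-plus-eta-split`,
## `Ko03-Lplus-omega-existential`)

**Take `p = 3` and `K := K_0 = ℚ(ζ₃) = ℚ(√−3)`.** The fields `K_n = ℚ(ζ_{3^{n+1}})`, `n ≥ 0`, are
exactly the layers of the cyclotomic `ℤ₃`-extension `K_∞ = ℚ(ζ_{3^∞})` of the number field `K`
(`[K_n : K] = 3ⁿ`), and `K` has ONE place `v = 𝔭 = (√−3)` above `3`, `K_{n,𝔭} = ℚ₃(ζ_{3^{n+1}})`.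
Hence the tree's `Kobayashi2003.signedSelmerLayer V' κ 1 n` (file `SignedSelmer.lean`: the
classical `Sel_{3^∞}` over the `n`-th layer of `κ` cut by the Kummer condition for
`E⁺ = {P | Tr_{n/m+1} P ∈ E(K_m·K_v) for (−1)^m = +1, m < n}` at every place above `3`) for
`κ : ZpExtension K 3` cyclotomic and a `K`-model `V'` of `E_K` IS Def. 2.1's `Sel⁺(E/K_n)` — the
PLUS condition of §2 involves only `0 ≤ m < n` (the extra `m = −1` clause belongs to the MINUS
sign, which is why only `+` is transcribed) — and `SignedSelmerDualData V' κ γ 1` is `X⁺(E/K_∞)`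
with `T = γ − 1` for `γ ∈ Γ_K` mapping to the generator `χ₃(γ) = 4 = 1 + 3` of
`Γ = Gal(K_∞/K) ≅ 1 + 3ℤ₃` (`cyclotomicGenerator 3`). NO descent along `ℚ(ζ_{3^∞}) ⊋ ℚ_∞` is used.

`Λ = ℤ₃[Δ]⟦X⟧` with `Δ = {±1}`, `3 ∤ #Δ`: `Λ = Λ(Γ)ε_1 ⊕ Λ(Γ)ε_ω` and every `Λ`-module is
`M = M^Δ ⊕ M^ω` (`ω = ` the quadratic character of `Δ`, ODD, of conductor `3`); Thm. 2.2 says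
`X⁺(E/K_∞)` — equivalently both components — is finitely generated and torsion over `Λ(Γ) = ℤ₃⟦X⟧`,
and the first display of Thm. 4.1 for `η = 1` AND for `η = ω` gives
`L₃⁺(E, X) ∈ Char(X⁺(E/K_∞)^Δ)`, `L₃⁺(E, ω, X) ∈ Char(X⁺(E/K_∞)^ω)` (with `pⁿ`; `n = 0` under
surjectivity), whence — characteristic ideals over `Λ(Γ)` being multiplicative over
`X⁺ = X^{+,Δ} ⊕ X^{+,ω}` — `Char_{Λ(Γ)} X⁺(E/K_∞) ∋ (3^{n}) · L₃⁺(E, X) · L₃⁺(E, ω, X)`.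

Currency. The trivial-character function is the tree's: `L ∈ Λ` with
`IsSignedPAdicLFunction f 3 1 L` (Kobayashi's `L_p⁺(E, X)` in the `Ω⁺_f`-normalisation — file
`SignedKatoDivisibility.lean`, unique; its constant term `2[0]⁺_f` is the tree theorem
`IsSignedPAdicLFunction.constantCoeff_eq_of_eq_one`), so that `L_p⁺(E, X)_{Néron} = ±ϖ · L` with
`ϖ · Ω_E = Ω⁺_f`. The tree has NO Mazur–Tate / Pollack vocabulary for the TAME BRANCH `η = ω`; the
`ω`-branch function is therefore transcribed EXISTENTIALLY and only through what the consumer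
needs — Thm. 3.2 (it exists) and (3.6) (its value at `X = 0`): there is `Lω ∈ ℚ₃⟦X⟧` (namely
`ϖ'⁻¹ · L₃⁺(E, ω, X)_{Néron}`, `ϖ' · |Ω⁻(E)| = Ω⁻_f`) whose constant term is
`e · ∑_{a mod 3} (a/3) [a/3]⁻_f`, `e ∈ ℤ₃^×`. Indeed by (3.6) with `η = ω`, `δ = −1`, `ω̄ = ω`:
`L₃⁺(E, ω, 0) = −(3/τ(ω)) L(E, ω, 1)/Ω⁻_E`, and by Birch's formula for the odd primitive character
`ω` (Mazur–Tate–Teitelbaum 1986 (8.6); tree theorem `ratMinusTwistedSymbolSum_mul_minusPeriod_mul_I`: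
`(∑_a ω(a)[a/3]⁻_f) · Ω⁻_f · i = τ(ω) · L(f, ω, 1)`), together with `τ(ω)² = ω(−1)·3 = −3`,
`L₃⁺(E, ω, 0) = (i Ω⁻_f/Ω⁻_E) · ∑_a (a/3)[a/3]⁻_f = (unit) · ϖ' · ∑_a (a/3)[a/3]⁻_f` (Kobayashi's
imaginary Néron period `Ω⁻_E ∈ iℝ` differs from `i|Ω⁻(E)| = i · imaginaryPeriodRat` by a sign and a
power of `2`). This ∃-form is WEAKER than print (it forgets which power series `L₃⁺(E, ω, X)` is
beyond its constant term) — TODO(general form): when the tree has the `ω^i`-branch Mazur–Tate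
elements, replace `∃ Lω` by the congruence predicate pinning Pollack's `L_p⁺(E, ω, X)`.
Periods: Kobayashi normalises by the Néron periods `Ω_E^±` (Thm. 3.1), the tree by `Ω^±_f`; the
product `L₃⁺(E,X) L₃⁺(E,ω,X)` (Néron) is `u · ϖϖ' · L · Lω`, `u ∈ ℤ₃^×` — exactly the translation
of the siblings A92/A99 (`Wuthrich2014.…CyclotomicThree`, `Kato2004.…CyclotomicThree_of_surjective`).

Hypotheses transcribed: `E = V` globally minimal over `ℚ`, good reduction at `3` with `a₃ = 0`
(`V.HasGoodReductionAtPrime 3`, `V.frobeniusTrace 3 = 0`; then `3` is supersingular); `p = 3` odd;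
"`Gal(ℚ̄/ℚ) → GL_{ℤ₃}(T)` surjective" as `∀ m, V.HasSurjectiveModNGaloisRep (3^m)` (as in the
`η = 1` sibling and in `kato_divisibility` (3)); `K` a cyclotomic extension `{3}` of `ℚ`; `V'` any
`K`-model of `E_K`; `κ` the cyclotomic `ℤ₃`-extension of `K` with topological generator `γ`,
`χ₃(γ) · ζ = 4` with `ζ` torsion (the `K`-form of `IsCyclotomicVariable`, as in A92/A99: Kobayashi
writes BOTH `X^±` and `L_p` in the one variable `γ ↦ 1 + X`, §3 p. 5); `f` the newform of `E`;
`D : SignedSelmerDualData V' κ γ 1` ANY Pontryagin-dual datum of `Sel⁺(E/K_∞)` (exists, unique up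
to `Λ`-isomorphism: `SignedSelmerDualExistsProofs` / `…UniquenessProofs`). Conclusion: `X⁺` is
finitely generated and `Λ`-torsion (Thm. 2.2) and, for some `Lω` with the displayed constant term,
(a) `∃ n`, `ι g = 3ⁿ u ϖϖ' · ι L · Lω` for some `g ∈ Char X⁺`; (b) under surjectivity the same
with `n = 0`.

What is NOT here: the sign `−` (its `m = −1` condition over `K_0` is not the tree's object over the
base `K`), `p ≠ 3`, the converse inclusions (main conjecture), Thm. 9.3 (control), any proof.
-- TODO(general form): Thm. 4.1 for every odd `p` over `K = ℚ(μ_p)` (product over all `p − 1`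
-- characters `η`), both signs, and Pollack's `L_p^±(E, η, X)` as named tree objects.

Consumer: `Summits/BirchSwinnertonDyer/Rank1Residual/Additive/XGssRankZeroCyclotomicThree*.lean`
(line V18): with the control inequality `ord₃ #Sel_{3^∞}(E/K) ≤ ord₃ f⁺(0)`
(`SignedSelmerControlZero`, from Kobayashi Lemma 9.1 + Kitajima–Otsuki 2018) and Milne's
Weil-restriction identity, this fact bounds `#Ш(V/ℚ)[3^∞] · #Ш(V^{(−3)}/ℚ)[3^∞]` for the ADDITIVE,
potentially supersingular twist `V^{(−3)}`.
-/

set_option autoImplicit false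

noncomputable section

open scoped Classical MatrixGroups ModularForm

open CongruenceSubgroup WeierstrassCurve Literature.NumberTheory.EllipticCurves
  Literature.NumberTheory.EllipticCurves.ModularForms
  Literature.NumberTheory.GaloisRepresentations

namespace Literature.NumberTheory.EllipticCurves.Kobayashi2003

/-- **Kobayashi 2003, Thm. 4.1 (sign `+`, `η = 1` and `η = ω`) with Thm. 2.2 and Thm. 3.2/(3.6),
at `p = 3`, read over `K = ℚ(ζ₃)`: `Char_{Λ(Γ)} X⁺(E/ℚ(ζ_{3^∞})) ∋ 3ⁿu · L₃⁺(E,X) · L₃⁺(E,ω,X)`,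
`n = 0` if `ρ_{E,3^∞}` is onto.** As printed (Invent. Math. 152, Thm. 4.1, p. 8): "There exists an
integer `n ≥ 0` such that `Char(X⁺(E/K_∞)^η) ⊇ (pⁿ L_p⁺(E, η, X))`, `Char(X⁻(E/K_∞)^Δ) ⊇
(pⁿ L_p⁻(E, X))`, `Char(X⁻(E/K_∞)^η) ⊇ (pⁿ X⁻¹ L_p⁻(E, η, X))` for `η ≠ 1`. If the `p`-adic
representation `Gal(ℚ̄/ℚ) → GL_{ℤ_p}(T)` is surjective, then we can take `n = 0`." — for `E/ℚ` with
good reduction at the odd prime `p` and `a_p = 0` (§2), `K_n = ℚ(ζ_{p^{n+1}})`, `K_∞ = ∪ K_n`,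
`X^±(E/K_∞)` the dual of `Sel^±(E/K_∞) = lim→ Sel^±(E/K_n)` (Def. 2.1), a finitely generated
torsion `Λ = ℤ_p[Δ][[X]]`-module (Thm. 2.2), `η` a character of `Δ = Gal(K_0/ℚ)`, `M^η = ε_η M`,
`γ ↦ 1 + X` (§3 p. 5), and `L_p^±(E, η, X) ∈ ℤ_p[[X]]` Pollack's functions (Thm. 3.2) with
(3.6) `L_p⁺(E, 0) = 2L(E,1)/Ω_E`, `L_p⁺(E, η, 0) = −(p/τ(η)) L(E, η̄, 1)/Ω_E^δ` (`η ≠ 1`). Here, for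
`p = 3` and the sign `+`: `K_∞ = ℚ(ζ_{3^∞})` is the cyclotomic `ℤ₃`-extension of `K = ℚ(ζ₃)`, so
`X⁺(E/K_∞)` is the tree's `SignedSelmerDualData V' κ γ 1` (Def. 2.1's plus condition has
`0 ≤ m < n` only) of any `K`-model `V'` of `E_K`, `κ` cyclotomic, `χ₃(γ)·ζ = 4`; `Λ = Λ(Γ)ε_1 ⊕
Λ(Γ)ε_ω` (`Δ = {±1}`) and `Char` is multiplicative over `X⁺ = X^{+,Δ} ⊕ X^{+,ω}`, so the first
display for BOTH `η` gives `3ⁿ · L₃⁺(E,X) · L₃⁺(E,ω,X) ∈ Char_{Λ(Γ)} X⁺(E/K_∞)`. In the tree's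
currency: `L` is any `IsSignedPAdicLFunction f 3 1 L` (Kobayashi's `L_p⁺(E,X)`, `Ω⁺_f`-normalised,
unique) and the `ω`-branch function enters EXISTENTIALLY as an `Lω ∈ ℚ₃⟦X⟧` whose constant term is
`e · ∑_{a mod 3}(a/3)[a/3]⁻_f`, `e ∈ ℤ₃^×` ((3.6) for `η = ω` + Birch's formula MTT (8.6), tree
theorem `ratMinusTwistedSymbolSum_mul_minusPeriod_mul_I`, `τ(ω)² = −3`; `Ω⁻_f = ϖ'|Ω⁻(E)|`);
Néron versus newform periods contribute `u · ϖϖ'`, `u ∈ ℤ₃^×`, as in the siblings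
`Wuthrich2014.charIdeal_dvd_padicLFunction_cyclotomicThree` /
`Kato2004.charIdeal_dvd_padicLFunction_cyclotomicThree_of_surjective`. Weaker than print (∃-form for
`L_p⁺(E,ω,X)`; sign `+` only); named fact, nothing asserted.
[cite: Kobayashi2003, Thm. 4.1 (p. 8) with Def. 2.1 and Thm. 2.2 (pp. 4–5), §3 (p. 5), Thm. 3.2 and (3.6)–(3.7) (p. 7); corpus `paper:doi-10-1007-s00222-002-0265-4` p0004, p0005, p0007, p0008]
[cite: MazurTateTeitelbaum1986Invent, §I.8 (8.6) (Birch's formula, odd character)] -/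
def thm41_plusCharIdeal_dvd_cyclotomicThree : Prop :=
  ∀ (V : WeierstrassCurve ℚ) [V.IsElliptic] [V.IsGloballyMinimal]
    (K : Type) [Field K] [NumberField K] [IsCyclotomicExtension {3} ℚ K]
    (V' : WeierstrassCurve K) [V'.IsElliptic]
    {κ : ZpExtension K 3} {γ : Field.absoluteGaloisGroup K} {N : ℕ} [NeZero N]
    {f : CuspForm (Gamma0 N) 2},
    V.HasGoodReductionAtPrime 3 → V.frobeniusTrace 3 = 0 →
    (∃ C : VariableChange K, C • V.baseChange K = V') →
    κ.IsCyclotomic → κ.IsTopGenerator γ →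
    (∃ ζ : ℤ_[3]ˣ, IsOfFinOrder ζ ∧
      ((GaloisRep.cyclotomicCharacter K 3 γ * ζ : ℤ_[3]ˣ) : ℤ_[3]) =
        (cyclotomicGenerator 3 : ℤ_[3])) →
    IsNewformOf V f →
    ∀ (L : IwasawaAlgebra 3), IsSignedPAdicLFunction f 3 1 L →
    ∀ (D : SignedSelmerDualData V' κ γ 1) (ϖ ϖ' : ℚ),
      (ϖ : ℝ) * V.realPeriodRat = plusPeriod f →
      (ϖ' : ℝ) * V.imaginaryPeriodRat = minusPeriod f →
      Module.Finite (IwasawaAlgebra 3) D.X ∧ Module.IsTorsion (IwasawaAlgebra 3) D.X ∧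
      ∃ Lω : PowerSeries ℚ_[3],
        (∃ e : ℤ_[3]ˣ, PowerSeries.constantCoeff Lω =
          ((e : ℤ_[3]) : ℚ_[3]) *
            ((∑ a : ZMod 3, (legendreSym 3 (a.val : ℤ) : ℚ) * ratMinusSymbol f ((a.val : ℚ) / 3) : ℚ) :
              ℚ_[3])) ∧
        (∃ n : ℕ, ∃ g ∈ D.charIdeal, ∃ u : ℤ_[3]ˣ,
          iwasawaToPowerSeries 3 g =
            PowerSeries.C (((u : ℤ_[3]) : ℚ_[3]) * (3 : ℚ_[3]) ^ n * (ϖ : ℚ_[3]) * (ϖ' : ℚ_[3])) *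
              (iwasawaToPowerSeries 3 L * Lω)) ∧
        ((∀ m : ℕ, V.HasSurjectiveModNGaloisRep (3 ^ m : ℕ)) →
          ∃ g ∈ D.charIdeal, ∃ u : ℤ_[3]ˣ,
            iwasawaToPowerSeries 3 g =
              PowerSeries.C (((u : ℤ_[3]) : ℚ_[3]) * (ϖ : ℚ_[3]) * (ϖ' : ℚ_[3])) *
                (iwasawaToPowerSeries 3 L * Lω))

end Literature.NumberTheory.EllipticCurves.Kobayashi2003

end
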